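import Literature.Probability.LatticeModels.ONModel
import HarnessLib

/-!
# Global `O(N)` symmetry of the free-boundary O(N) measure: proof of `onMeasure_free_map_rotate`

Companion ("Proofs") file of `Literature/Probability/LatticeModels/ONModel.lean`. That file
defines the finite-volume Gibbs measure `onMeasure G Λ β bc` of the classical O(N) model
(`Measure.tilted` of the glued product of uniform sphere measures by `exp (-β H_Λ^{bc})`) and
records as a NAMED FACT `onMeasure_free_map_rotate` the global `O(N)` invariance of the
free-boundary measure on `Λ`-local events (Friedli–Velenik 2017, §9.1–9.2: the Hamiltonian (9.2)
is invariant under the global rotation `(r ω)_i = R ω_i`, eq. (9.3), and so is the a priori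
(Lebesgue) measure on `𝕊^{N-1}`, whence the Gibbs distribution is `r`-invariant, §6.6). It is
PROVED here (`onMeasure_free_map_rotate_holds`):

* `map_rotate_toSphere`, `measurePreserving_sphereUniform_rotate` — the uniform measure on
  `𝕊^{N-1}` (Mathlib's `Measure.toSphere` of Lebesgue measure, normalised) is invariant under the
  restriction of a linear isometry `R` to the sphere: by `Measure.toSphere_apply'` the measure of
  `s` is `N · vol (Ioo 0 1 • s)`, the cone over `R⁻¹ s` is `R⁻¹` of the cone over `s`, and `R`
  preserves Lebesgue measure (`LinearIsometryEquiv.measurePreserving`);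
* `measurePreserving_onReference_rotate` — hence the product reference measure `⊗_{x∈Λ} dω` is
  invariant under the sitewise rotation (Mathlib `measurePreserving_pi`);
* `glueWith_rotate_onGlue`, `onHamiltonian_free_rotateIn`, `measurable_rotateIn` — the rotation
  `s ↦ glueWith Λ (R s|_Λ) s` of the spins INSIDE `Λ` only commutes with the free gluing
  (`onGlue Λ · .free`, whose outside value is the junk reference spin) and leaves the free
  Hamiltonian invariant (its edges `edgesIn G Λ` have both endpoints in `Λ`, and
  `⟪R u, R v⟫ = ⟪u, v⟫`);
* `map_tilted_comp`, `map_tilted_eq_of_invariant` — push-forward commutes with tilting,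
  `(μ.tilted (g ∘ Φ)).map Φ = (μ.map Φ).tilted g`, so a `Φ`-invariant measure tilted by a
  `Φ`-invariant density is `Φ`-invariant; this gives `onMeasure_free_map_rotateIn`, the
  invariance of `μ_{Λ;β}^{free}` under the rotation inside `Λ`;
* `onMeasure_free_map_rotate_holds` — an event of `cylinderEvents Λ` is a preimage under the
  restriction `s ↦ s|_Λ`, on which the global rotation `ONConfig.rotate R` and the rotation
  inside `Λ` agree, so their preimages of such an event coincide.

No new definitions, no named facts. Mathlib anchors: `Measure.toSphere_apply'`,
`LinearIsometryEquiv.measurePreserving`, `MeasurePreserving.measure_preimage_emb`,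
`measurePreserving_pi`, `tilted_apply'`, `setLIntegral_map`, `integral_map`, `Measure.map_map`,
`cylinderEvents_le_pi`, `MeasurableSpace.comap_comp`.

## References

* S. Friedli, Y. Velenik, *Statistical Mechanics of Lattice Systems* (CUP 2017), §9.1 (the O(N)
  models, eq. (9.2)), §9.2 (global rotations, eq. (9.3)), §6.6 (internal symmetries of Gibbsian
  specifications, Def. 6.44).
-/

noncomputable section

open MeasureTheory Finset Set
open scoped RealInnerProductSpace ENNReal Pointwise

namespace Literature.Probability.LatticeModels

variable {V : Type*} {N : ℕ}

/-! ### Rotation invariance of the uniform measure on the sphere -/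

/-- A linear isometry `R` of `ℝ^N` maps the unit sphere `𝕊^{N-1}` to itself
(Friedli–Velenik 2017, §9.2, `R ω_i ∈ 𝕊^{N-1}`). [cite: FriedliVelenik2017, §9.2] -/
theorem SphereSpin.rotate_mem (R : EuclideanSpace ℝ (Fin N) ≃ₗᵢ[ℝ] EuclideanSpace ℝ (Fin N))
    (v : SphereSpin N) : R v ∈ Metric.sphere (0 : EuclideanSpace ℝ (Fin N)) 1 := by
  simp [R.norm_map]

/-- The restriction `v ↦ R v` of a linear isometry to the sphere is measurable (it is
continuous). [folklore] -/
theorem SphereSpin.measurable_rotate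
    (R : EuclideanSpace ℝ (Fin N) ≃ₗᵢ[ℝ] EuclideanSpace ℝ (Fin N)) :
    Measurable fun v : SphereSpin N => (⟨R v, SphereSpin.rotate_mem R v⟩ : SphereSpin N) :=
  (R.continuous.measurable.comp measurable_subtype_coe).subtype_mk

/-- **The cone measure on the sphere is rotation invariant**: for a linear isometry `R` of
`ℝ^N`, the push-forward of `volume.toSphere` under `v ↦ R v` is `volume.toSphere`. By
`Measure.toSphere_apply'`, `toSphere s = N · vol (Ioo 0 1 • s)`; the cone over `R⁻¹ s` is `R⁻¹`
of the cone over `s`, and `R` preserves Lebesgue measure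
(`LinearIsometryEquiv.measurePreserving`). [folklore] -/
theorem map_rotate_toSphere (R : EuclideanSpace ℝ (Fin N) ≃ₗᵢ[ℝ] EuclideanSpace ℝ (Fin N)) :
    (volume : Measure (EuclideanSpace ℝ (Fin N))).toSphere.map
        (fun v : SphereSpin N => (⟨R v, SphereSpin.rotate_mem R v⟩ : SphereSpin N)) =
      (volume : Measure (EuclideanSpace ℝ (Fin N))).toSphere := by
  have hfm := SphereSpin.measurable_rotate R
  refine Measure.ext fun s hs => ?_
  rw [Measure.map_apply hfm hs, Measure.toSphere_apply' _ (hfm hs), Measure.toSphere_apply' _ hs]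
  congr 1
  have himg : ((↑) : SphereSpin N → EuclideanSpace ℝ (Fin N)) ''
        ((fun v : SphereSpin N => (⟨R v, SphereSpin.rotate_mem R v⟩ : SphereSpin N)) ⁻¹' s) =
      R ⁻¹' (((↑) : SphereSpin N → EuclideanSpace ℝ (Fin N)) '' s) := by
    ext y
    simp only [mem_image, Set.mem_preimage]
    constructor
    · rintro ⟨ω, hω, rfl⟩
      exact ⟨_, hω, rfl⟩
    · rintro ⟨ω', hω', hy⟩
      have hy1 : y ∈ Metric.sphere (0 : EuclideanSpace ℝ (Fin N)) 1 := by
        rw [mem_sphere_zero_iff_norm, ← R.norm_map y, ← hy]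
        exact norm_eq_of_mem_sphere ω'
      refine ⟨⟨y, hy1⟩, ?_, rfl⟩
      have : (⟨R y, SphereSpin.rotate_mem R ⟨y, hy1⟩⟩ : SphereSpin N) = ω' := Subtype.ext hy.symm
      show (⟨R y, SphereSpin.rotate_mem R ⟨y, hy1⟩⟩ : SphereSpin N) ∈ s
      rw [this]
      exact hω'
  have hsmul : Ioo (0 : ℝ) 1 • (R ⁻¹' (((↑) : SphereSpin N → EuclideanSpace ℝ (Fin N)) '' s)) =
      R ⁻¹' (Ioo (0 : ℝ) 1 • (((↑) : SphereSpin N → EuclideanSpace ℝ (Fin N)) '' s)) := by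
    ext z
    simp only [Set.mem_smul, Set.mem_preimage]
    constructor
    · rintro ⟨r, hr, y, hy, rfl⟩
      exact ⟨r, hr, R y, hy, by simp⟩
    · rintro ⟨r, hr, w, hw, hz⟩
      refine ⟨r, hr, R.symm w, by simpa using hw, ?_⟩
      apply R.injective
      simpa using hz
  rw [himg, hsmul]
  exact R.measurePreserving.measure_preimage_emb R.toHomeomorph.measurableEmbedding _

/-- **The uniform probability measure on `𝕊^{N-1}` is rotation invariant**: `v ↦ R v` preserves
`sphereUniform N` for every linear isometry `R` of `ℝ^N` (the a priori measure of the O(N)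
model is `O(N)`-invariant; Friedli–Velenik 2017, §9.1–9.2). [cite: FriedliVelenik2017, §9.2] -/
theorem measurePreserving_sphereUniform_rotate
    (R : EuclideanSpace ℝ (Fin N) ≃ₗᵢ[ℝ] EuclideanSpace ℝ (Fin N)) :
    MeasurePreserving (fun v : SphereSpin N => (⟨R v, SphereSpin.rotate_mem R v⟩ : SphereSpin N))
      (sphereUniform N) (sphereUniform N) := by
  refine ⟨SphereSpin.measurable_rotate R, ?_⟩
  rw [sphereUniform, Measure.map_smul, map_rotate_toSphere]

/-- The product reference measure `⊗_{x ∈ Λ} dω(s_x)` is invariant under the sitewise rotation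
`ζ ↦ (R ζ_x)_{x ∈ Λ}` (Friedli–Velenik 2017, §9.2 with §6.6; Mathlib `measurePreserving_pi`). [cite: FriedliVelenik2017, §9.2] -/
theorem measurePreserving_onReference_rotate (Λ : Finset V)
    (R : EuclideanSpace ℝ (Fin N) ≃ₗᵢ[ℝ] EuclideanSpace ℝ (Fin N)) :
    MeasurePreserving (ONConfig.rotate (V := Λ) R) (onReference N Λ) (onReference N Λ) :=
  measurePreserving_pi (fun _ : Λ => sphereUniform N) (fun _ : Λ => sphereUniform N)
    fun _ => measurePreserving_sphereUniform_rotate R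

/-! ### The rotation of the spins inside `Λ` -/

/-- Rotating the spins inside `Λ` of a configuration glued with the free boundary condition is
gluing the rotated finite configuration: the (junk) outside spins are untouched
(Friedli–Velenik 2017, §9.1). [cite: FriedliVelenik2017, §9.1] -/
theorem glueWith_rotate_onGlue [NeZero N] (Λ : Finset V)
    (R : EuclideanSpace ℝ (Fin N) ≃ₗᵢ[ℝ] EuclideanSpace ℝ (Fin N)) (ζ : Λ → SphereSpin N) :
    glueWith Λ (fun i : Λ => ONConfig.rotate R (onGlue Λ ζ .free) i) (onGlue Λ ζ .free) =
      onGlue Λ (ONConfig.rotate R ζ) .free := by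
  funext x
  apply Subtype.ext
  by_cases hx : x ∈ Λ
  · simp [onGlue, hx]
  · simp [onGlue, hx]

/-- The free-boundary Hamiltonian is invariant under the rotation of the spins inside `Λ`:
every edge of `ℰ_Λ` has both endpoints in `Λ` and `⟪R u, R v⟫ = ⟪u, v⟫`
(Friedli–Velenik 2017, eq. (9.3)). [cite: FriedliVelenik2017, eq. (9.3)] -/
theorem onHamiltonian_free_rotateIn (G : SimpleGraph V) [DecidableEq V] [G.LocallyFinite]
    (Λ : Finset V) (R : EuclideanSpace ℝ (Fin N) ≃ₗᵢ[ℝ] EuclideanSpace ℝ (Fin N))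
    (s : ONConfig V N) :
    onHamiltonian G Λ .free (glueWith Λ (fun i : Λ => ONConfig.rotate R s i) s) =
      onHamiltonian G Λ .free s := by
  unfold onHamiltonian
  congr 1
  refine Finset.sum_congr rfl fun e he => ?_
  have he' : ∀ x ∈ e, x ∈ Λ := by
    simp only [ONBoundary.interactionEdges_free, mem_edgesIn_iff] at he
    exact he.2
  revert he'
  induction e using Sym2.ind with
  | _ x y =>
    intro hxy
    have hx : x ∈ Λ := hxy x (Sym2.mem_mk_left x y)
    have hy : y ∈ Λ := hxy y (Sym2.mem_mk_right x y)
    simp [hx, hy, LinearIsometryEquiv.inner_map_map]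

/-- The rotation of the spins inside `Λ`, `s ↦ glueWith Λ (R s|_Λ) s`, is measurable
(Friedli–Velenik 2017, §6.6). [folklore] -/
theorem measurable_rotateIn (Λ : Finset V)
    (R : EuclideanSpace ℝ (Fin N) ≃ₗᵢ[ℝ] EuclideanSpace ℝ (Fin N)) :
    Measurable fun s : ONConfig V N => glueWith Λ (fun i : Λ => ONConfig.rotate R s i) s := by
  refine measurable_pi_lambda _ fun x => ?_
  by_cases hx : x ∈ Λ
  · simp only [glueWith_apply_mem _ _ _ hx]
    exact (measurable_pi_apply _).comp (ONConfig.measurable_rotate R)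
  · simp only [glueWith_apply_not_mem _ _ _ hx]
    exact measurable_pi_apply x

/-! ### Push-forward and tilting -/

/-- Push-forward commutes with tilting: `(μ.tilted (g ∘ Φ)).map Φ = (μ.map Φ).tilted g` for
measurable `Φ` and `g` (both sides have normaliser `∫ exp (g ∘ Φ) dμ` and give a measurable `s`
the mass `∫_{Φ⁻¹ s} exp (g ∘ Φ) / Z dμ`; change of variables, Mathlib `setLIntegral_map`,
`integral_map`). [folklore] -/
theorem map_tilted_comp {α γ : Type*} [MeasurableSpace α] [MeasurableSpace γ] (μ : Measure α)
    {Φ : α → γ} (hΦ : Measurable Φ) {g : γ → ℝ} (hg : Measurable g) :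
    (μ.tilted (g ∘ Φ)).map Φ = (μ.map Φ).tilted g := by
  refine Measure.ext fun s hs => ?_
  rw [Measure.map_apply hΦ hs, tilted_apply' _ _ (hΦ hs), tilted_apply' _ _ hs,
    integral_map hΦ.aemeasurable hg.exp.aestronglyMeasurable,
    setLIntegral_map hs (by fun_prop) hΦ]
  rfl

/-- A `Φ`-invariant measure tilted by a `Φ`-invariant density is `Φ`-invariant:
if `μ.map Φ = μ` and `g ∘ Φ = g` then `(μ.tilted g).map Φ = μ.tilted g` (the mechanism behind
the `G`-invariance of Gibbsian specifications with a `G`-invariant potential, Friedli–Velenik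
2017, §6.6, discussion after Def. 6.44). [cite: FriedliVelenik2017, §6.6] -/
theorem map_tilted_eq_of_invariant {α : Type*} [MeasurableSpace α] (μ : Measure α)
    {Φ : α → α} (hΦ : Measurable Φ) (hμ : μ.map Φ = μ) {g : α → ℝ} (hg : Measurable g)
    (hinv : ∀ x, g (Φ x) = g x) : (μ.tilted g).map Φ = μ.tilted g := by
  have hcomp : g = g ∘ Φ := funext fun x => (hinv x).symm
  conv_lhs => rw [hcomp]
  rw [map_tilted_comp μ hΦ hg, hμ]

/-! ### Invariance of the free-boundary measure -/

/-- **Invariance of `μ_{Λ;β}^{free}` under the rotation of the spins inside `Λ`**: the glued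
reference measure is invariant (product of rotation-invariant sphere measures, the outside junk
spins untouched) and so is the free Hamiltonian, hence so is the tilted measure
(Friedli–Velenik 2017, §9.2, eq. (9.3) with §6.6). [cite: FriedliVelenik2017, §9.2 eq. (9.3) with §6.6] -/
theorem onMeasure_free_map_rotateIn [NeZero N] (G : SimpleGraph V) [DecidableEq V]
    [G.LocallyFinite] (Λ : Finset V) (β : ℝ)
    (R : EuclideanSpace ℝ (Fin N) ≃ₗᵢ[ℝ] EuclideanSpace ℝ (Fin N)) :
    (onMeasure G Λ β .free).map
        (fun s : ONConfig V N => glueWith Λ (fun i : Λ => ONConfig.rotate R s i) s) =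
      onMeasure G Λ β .free := by
  have hΦm := measurable_rotateIn (V := V) Λ R
  have hν : ((onReference N Λ).map (onGlue Λ · .free)).map
      (fun s : ONConfig V N => glueWith Λ (fun i : Λ => ONConfig.rotate R s i) s) =
      (onReference N Λ).map (onGlue Λ · .free) := by
    rw [Measure.map_map hΦm (measurable_onGlue Λ _)]
    have hcomp : (fun s : ONConfig V N => glueWith Λ (fun i : Λ => ONConfig.rotate R s i) s) ∘
        (onGlue Λ · ONBoundary.free) =
        (onGlue Λ · ONBoundary.free) ∘ ONConfig.rotate (V := Λ) R :=
      funext fun ζ => glueWith_rotate_onGlue Λ R ζ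
    rw [hcomp, ← Measure.map_map (measurable_onGlue Λ _) (ONConfig.measurable_rotate R),
      (measurePreserving_onReference_rotate Λ R).map_eq]
  unfold onMeasure
  exact map_tilted_eq_of_invariant _ hΦm hν
    ((measurable_onHamiltonian G Λ _).const_mul _)
    fun s => by rw [onHamiltonian_free_rotateIn]

/-- **Global `O(N)` invariance of the free-boundary O(N) measure on `Λ`-local events**
(discharge of the named fact `onMeasure_free_map_rotate`): for every linear isometry `R` of
`ℝ^N` and every event `A ∈ cylinderEvents Λ`,
`(μ_{Λ;β}^{free} ∘ (rotate R)⁻¹)(A) = μ_{Λ;β}^{free}(A)`. An event of `cylinderEvents Λ` is a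
preimage under the restriction `s ↦ s|_Λ`, on which the global rotation and the rotation of the
spins inside `Λ` agree; the latter preserves `μ_{Λ;β}^{free}` (`onMeasure_free_map_rotateIn`)
(Friedli–Velenik 2017, §9.2, eq. (9.3): the Hamiltonian and the a priori measure are invariant
under global rotations, with §6.6, `G`-invariance of the Gibbsian specification). [cite: FriedliVelenik2017, §9.2 eq. (9.3) with §6.6] -/
theorem onMeasure_free_map_rotate_holds : onMeasure_free_map_rotate (V := V) (N := N) := by
  intro _ G _ _ Λ β R A hA
  have hA' : MeasurableSet A := cylinderEvents_le_pi _ hA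
  -- an event of `cylinderEvents Λ` is a preimage under the restriction to `Λ`
  have hle : cylinderEvents (X := fun _ : V => SphereSpin N) (↑Λ : Set V) ≤
      MeasurableSpace.comap (fun σ : ONConfig V N => Set.restrict (↑Λ : Set V) σ) ⊤ := by
    refine iSup₂_le fun x hx => ?_
    have hcomp : (fun σ : ONConfig V N => σ x) =
        (fun g : (↑Λ : Set V) → SphereSpin N => g ⟨x, hx⟩) ∘
          fun σ : ONConfig V N => Set.restrict (↑Λ : Set V) σ := rfl
    rw [hcomp, ← MeasurableSpace.comap_comp]
    exact MeasurableSpace.comap_mono le_top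
  obtain ⟨B, -, hB⟩ := hle _ hA
  -- on such events the global rotation and the rotation inside `Λ` have the same preimage
  have hpre : ONConfig.rotate R ⁻¹' A =
      (fun s : ONConfig V N => glueWith Λ (fun i : Λ => ONConfig.rotate R s i) s) ⁻¹' A := by
    rw [← hB]
    ext s
    simp only [Set.mem_preimage]
    have hres : Set.restrict (↑Λ : Set V) (ONConfig.rotate R s) =
        Set.restrict (↑Λ : Set V) (glueWith Λ (fun i : Λ => ONConfig.rotate R s i) s) := by
      funext i
      simp [Set.restrict_apply]
    rw [hres]
  rw [Measure.map_apply (ONConfig.measurable_rotate R) hA', hpre,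
    ← Measure.map_apply (measurable_rotateIn Λ R) hA', onMeasure_free_map_rotateIn G Λ β R]

end Literature.Probability.LatticeModels
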